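import Literature.AlgebraicGeometry.ShimuraVarieties.UnitaryShimuraCurveHeckeComplex
import Literature.AlgebraicGeometry.ShimuraVarieties.UnitaryShimuraCurveHeckeDescent
import Literature.AlgebraicGeometry.ShimuraVarieties.UnitaryShimuraCurveLevelQuotient
import HarnessLib

/-!
# Hecke translates of Deligne's canonical model of the unitary Shimura CURVE are defined over the reflex field, and its
# levels are quotients of one another — conjuncts (u1) and (u4) of ★ `exists_recordSystemGS` PROVED for every curve record

Topic `AlgebraicGeometry/ShimuraVarieties`, namespace `…ShimuraVarieties.UnitaryCanonicalModel` (object: the record system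
`RecordSystemGS L J⋆ τ K₀` of ★ `UnitaryShimuraCurveRecord`). THEOREMS ONLY (no definition, no named fact, no `sorry`); the
rank-2 twin of ★ `UnitaryShimuraCanonicalModelHeckeHolds`.

* `RecordSystemGS.heckeTranslateDefinedOver_holds` — **(u1) [Milne2005ShimuraVarieties] Thm. 13.6 for the curve record**: for a
  hermitian non-degenerate `J⋆` every record system `S` HAS its Hecke translates over `L` (`S.HeckeTranslateDefinedOver`, ★ GS-2b):
  the complex half ★ `RecordSystemGS.exists_heckeComplex` (Hecke translations between compact disc quotients are morphisms —
  holomorphy descends along the open uniformisation of the one-dimensional pieces, ★ `HolomorphyDescent`; GAGA = Arapura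
  Cor. 15.4.6) fed to the descent half ★ `RecordSystemGS.heckeTranslateDefinedOver_of_complex` (reciprocity at the CM pairs +
  density of one Hecke orbit + [Milne2005ShimuraVarieties] Prop. 13.1);
* `RecordSystemGS.isLevelQuotient_holds` — **(u4) [Deligne1979ShimuraVarieties] 2.7.1 (c) for the curve record**: `M⋆_K = M⋆_N/(K/N)`
  (`S.IsLevelQuotient`), by ★ `RecordSystemGS.isLevelQuotient_of_heckeTranslateDefinedOver` over (u1).

Cell `hodgecm-mathlib`, GS programme (A-plan2 dossier A.17; A-p10 census §3 rows L-u1c / L-u4): after these, the cited fact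
★ `exists_recordSystemGS` (GS-3) owes only existence (u0) and the embedding clause (u2).

## References
* [Milne2005ShimuraVarieties] J. S. Milne, *Introduction to Shimura varieties* (2005/2017), Prop. 13.1 p. 117, Thm. 13.6 p. 118.
* [Deligne1979ShimuraVarieties] P. Deligne, *Variétés de Shimura* (1979), 2.1.4, 2.7.1 (b)–(c), Cor. 2.7.21.
-/

set_option autoImplicit false

noncomputable section

open NumberField Matrix
open scoped Matrix
open Literature.NumberTheory.Automorphic Literature.NumberTheory.Automorphic.UnitaryGroup
open Literature.NumberTheory.Automorphic.Liu2021.AppendixC (C5.OpenCompactSubgroup C5.SmallLevel)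

namespace Literature.AlgebraicGeometry.ShimuraVarieties.UnitaryCanonicalModel

variable {L : Type} [Field L] [NumberField L] [IsCMField L] {Jstar : Matrix (Fin 2) (Fin 2) L} {τ : L →+* ℂ}
  {K₀ : C5.OpenCompactSubgroup ↥(finAdelic (↥(maximalRealSubfield L)) L (IsCMField.complexConj L) 2 Jstar)}

/-- **(u1) [Milne2005ShimuraVarieties] Thm. 13.6 for Deligne's canonical model of the unitary Shimura curve**: for `J⋆` hermitian
(`ᵗ(c J⋆) = J⋆`) and non-degenerate, every record system `S` has its Hecke translates `T_g : M⋆_K ⟶ M⋆_{K'}` (`g⁻¹Kg ≤ K'`)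
defined over `L`, acting as `[v, aK] ↦ [v, agK']` on complex points — ★ `exists_heckeComplex` ∘ ★ `heckeTranslateDefinedOver_of_complex`.
[cite: Milne2005ShimuraVarieties, Thm. 13.6 p. 118 L21–41; Prop. 13.1 p. 117] [cite: Deligne1979ShimuraVarieties, 2.1.4 and Cor. 2.7.21] -/
theorem RecordSystemGS.heckeTranslateDefinedOver_holds (S : RecordSystemGS L Jstar τ K₀)
    (hJ : (Jstar.map (IsCMField.complexConj L))ᵀ = Jstar) (hdet : IsUnit Jstar.det) : S.HeckeTranslateDefinedOver :=
  S.heckeTranslateDefinedOver_of_complex hJ hdet fun g K K' hg => S.exists_heckeComplex K K' g hg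

/-- **(u4) [Deligne1979ShimuraVarieties] 2.7.1 (c) for the curve record**: for `J⋆` hermitian and non-degenerate, the levels of every
record system are quotients of one another, `M⋆_K = M⋆_N / (K/N)` (`S.IsLevelQuotient`) — ★
`isLevelQuotient_of_heckeTranslateDefinedOver` over (u1). [cite: Deligne1979ShimuraVarieties, 2.7.1 (b)–(c)]
[cite: Milne2005ShimuraVarieties, Rem. 5.29 (c) p. 65 and Thm. 13.6 p. 118] -/
theorem RecordSystemGS.isLevelQuotient_holds (S : RecordSystemGS L Jstar τ K₀)
    (hJ : (Jstar.map (IsCMField.complexConj L))ᵀ = Jstar) (hdet : IsUnit Jstar.det) : S.IsLevelQuotient :=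
  S.isLevelQuotient_of_heckeTranslateDefinedOver (S.heckeTranslateDefinedOver_holds hJ hdet)

end Literature.AlgebraicGeometry.ShimuraVarieties.UnitaryCanonicalModel

end
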